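import Summits.QuantumFields.BalabanUV.T4Continuum.Spine.NE9.SchurMemory
import Summits.QuantumFields.BalabanUV.Beta.EriceRemainderEnclosureHistoryRenewalStretched

/-!
# T⁴ programme, spine estimate NE9 (node U3, history side) — the two JUNCTIONS of the Schur currencies: E-side ROWS feed the
# β-side row hypothesis of station (E33) through the read-out, and E-side COLUMNS together with (E33)'s K-uniform coupling matching
# (ANY summable K-uniform profile: the record's `C·θ^j`, or (E33g)'s stretched `L·ρ^⌊√j⌋` WITHOUT `FadingMemory`) feed node U6 —
# census item of cell `pub-balaban-gaps`, seat ne9 (gen 3)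

Cell `pub-balaban-gaps` (YM blitz G2, seat ne9, unit `pub-balaban-gaps-ne9-g3`; record `run/shared/lean/pub/pub-balaban-gaps/ne/NE9.md`
§5 rows C20 ∕ C21, regime clause).  Summits-side bookkeeping; by-name inputs: this seat's `Spine/NE9/SchurMemory` (`historySum_le_of_rowSum`,
`summable_delta_of_colSum`), node U2's `T4CouplingMatching.disc` ∕ `abs_sub_le_of_inv_sq`, and the b2b station (E33g)
`Beta/EriceRemainderEnclosureHistoryRenewalStretched` (`summable_pow_sqrt`; its END `disc_le_sqrt_uniform_sign` is QUOTED AS A HYPOTHESIS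
SHAPE `hstr`, never asserted).  Nothing of the row's `Support/NE9*` modules or of the Beta cell's files is edited.

WHY.  `SchurMemory` settled which Schur norm of NE9's history moduli each consumer needs (rows: U5b and the β-side; columns: U3 → U6) and
left the two junctions in prose: (J1) «the read-out E → β acts row by row», (J2) «columns reach U6 given K-UNIFORMLY ℓ¹ coupling
discrepancies from node U2».  This file types both, literally against the neighbours' shapes:
* (J1) `readOut_nonneg`, `rowSum_readOut_le`: E-side rows `Σ_{i≤k} Λ k i ≤ M` ⇒ the β-moduli family `fun k i ↦ cr·Λ (k+1) i` — the
  SHAPE in which node U2's read-out returns `HistLipschitz` (`Support/NE4ReadOutSocket.ne4_of_endNE9_endNE5`: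
  `HistLipschitz (fun k i => cr * Λ (k+1) i) γ β`) — is nonnegative with rows `≤ cr·M`: exactly the pair (`hΛ`, `hrow`) of (E33)'s
  `disc_row_split` ∕ `disc_le_sqrt_uniform_sign` ∕ `disc_le_log_eventual`.  So «NE9′ for node U2» = E-side ROW bound, as (R28) says.
* (J2) `couplingDisc_le_of_disc`: inside the window `]0, γ]` the coupling discrepancy is dominated by node U2's recursion-variable
  discrepancy, `|g^K_i − g^{K+1}_{i+1}| ≤ γ³·disc (g K) (g (K+1)) i` (`abs_sub_le_of_inv_sq`); `summable_delta_of_colSum_profile`: E-side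
  COLUMNS `≤ M_c` + ANY K-uniform summable matching profile `disc (g K) (g (K+1)) j ≤ p_j` (`j ≤ K`) ⇒ node U6's
  `Summable (T4CauchySum.delta E ρ inj)` for every injection under U3's coupling bracket `Σ_{i<j} Λ j i·|g^K_i − g^{K+1}_{i+1}|`;
  instances `summable_delta_of_colSum_geometric` (the record's regime `p_j = C·θ^j`, i.e. node U2 WITH β-side `FadingMemory`,
  `T4CouplingMatching.disc_le_of_fadingMemory`) and `summable_delta_of_colSum_sqrt` ((E33g)'s regime `p_j = L·ρ^⌊√j⌋`, node U2 WITHOUT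
  `FadingMemory`, hypothesis `hstr` verbatim as in `EriceRemainderEnclosureHistoryRenewalStretched.tendsto_invSq_tail_of_uniform`).
  Hence, along the history channel, node U6 closes with NO `FadingMemory` ON EITHER SIDE: β-side rows (E33) + E-side columns (C21) —
  both of which Bałaban's geometric step supplies under the one clause N2 (`SchurRenewal`).  The (E33c) K-DEPENDENT form
  `(2K+2)·r^⌊√j⌋` is not a K-uniform profile and is not covered here (there (E33d) convolves on the β-side; the E-side analogue would
  need E-side fading, not columns).
For the classification of NE9 this is NEUTRAL (WORK-bound on W1; N2 parametric), as are C20–C22.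

WHAT IS PROVED (kernel; elementary real analysis, `[folklore]`): `readOut_nonneg`, `rowSum_readOut_le`, `couplingDisc_le_of_disc`,
`historySum_le_profile`, `summable_delta_of_colSum_profile`, `summable_delta_of_colSum_geometric`, `summable_delta_of_colSum_sqrt`.

HONEST FRAMING: bookkeeping for rung (B)+1 on a FIXED finite four-torus; facts about SHAPES (NE9's moduli, node U2's `disc`, node U6's
`delta`), not about Bałaban's functionals or β-functions; NE9 NOT PRINTED ∕ NOT PROVED; (E33g)'s END is a theorem about an ABSTRACT family
`β : FlowStep.HBeta` under NAMED BINDERS and enters here only as the hypothesis shape `hstr`; spine PROVED 0∕9 unchanged; NOT UV stability,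
NOT the continuum limit, NOT infinite volume, NOT a mass gap, NOT Clay.  HONEST DEPENDENCY: continuum YM on T⁴ ⇐ BetaPertH ∧ nine spine
estimates (0∕9 proved); BetaPertH ⇐ (D1) ∧ (D4) ∧ CAP+tail.

References (TYPES only): [Balaban1987RG1] = T. Bałaban, Commun. Math. Phys. **109** (1987) 249–301, (0.20) p. 256, p. 263, p. 298.
-/

namespace Summit.QuantumFields.BalabanUV.T4Continuum.NE9.SchurMemoryJunction

open scoped BigOperators
open Finset Filter Topology
open Literature.MathematicalPhysics.QuantumFieldTheory.Balaban1983to89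
open Literature.MathematicalPhysics.QuantumFieldTheory.Balaban1983to89.T4OutputRate
open Literature.MathematicalPhysics.QuantumFieldTheory.Balaban1983to89.T4CouplingMatching (disc abs_sub_le_of_inv_sq)
open T4CauchySum (delta)
open Summit.QuantumFields.BalabanUV.T4Continuum.NE9.SchurMemory (historySum_le_of_rowSum summable_delta_of_colSum)
open Summit.QuantumFields.BalabanUV.Beta.EriceRemainderEnclosureHistoryRenewalStretched (summable_pow_sqrt)

/-! ## (J1) E-side rows ⇒ the β-side row hypothesis of (E33), through the read-out shape `cr·Λ (k+1) i` -/

/-- The read-out family `fun k i ↦ cr·Λ (k+1) i` of nonnegative moduli is nonnegative (`cr ≥ 0`) — (E33)'s binder `hΛ`. [folklore] -/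
theorem readOut_nonneg {Λ : ℕ → ℕ → ℝ} {cr : ℝ} (hΛ : ∀ k i, i ≤ k → 0 ≤ Λ k i) (hcr : 0 ≤ cr) :
    ∀ k i, i ≤ k → 0 ≤ (fun k i => cr * Λ (k + 1) i) k i :=
  fun k i hik => mul_nonneg hcr (hΛ (k + 1) i (hik.trans (Nat.le_succ k)))

/-- **(J1) ROWS THROUGH THE READ-OUT.**  E-side rows `Σ_{i≤k} Λ k i ≤ M` (nonnegative moduli) ⇒ the read-out family
`fun k i ↦ cr·Λ (k+1) i` (`cr ≥ 0`; the shape of `NE4ReadOutSocket.ne4_of_endNE9_endNE5`'s `HistLipschitz` conclusion) has rows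
`Σ_{i≤k} cr·Λ (k+1) i ≤ cr·M` — (E33)'s binder `hrow : ∀ k, Σ_{i ∈ range (k+1)} Λβ k i ≤ M′` with `M′ = cr·M`. [folklore] -/
theorem rowSum_readOut_le {Λ : ℕ → ℕ → ℝ} {M cr : ℝ} (hΛ : ∀ k i, i ≤ k → 0 ≤ Λ k i)
    (hrow : ∀ k, ∑ i ∈ range (k + 1), Λ k i ≤ M) (hcr : 0 ≤ cr) (k : ℕ) :
    ∑ i ∈ range (k + 1), (fun k i => cr * Λ (k + 1) i) k i ≤ cr * M := by
  have hsub : ∑ i ∈ range (k + 1), Λ (k + 1) i ≤ ∑ i ∈ range (k + 1 + 1), Λ (k + 1) i :=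
    sum_le_sum_of_subset_of_nonneg (range_mono (Nat.le_succ _))
      fun i hi _ => hΛ (k + 1) i (Nat.lt_succ_iff.mp (mem_range.mp hi))
  calc ∑ i ∈ range (k + 1), (fun k i => cr * Λ (k + 1) i) k i = cr * ∑ i ∈ range (k + 1), Λ (k + 1) i := by
        rw [mul_sum]
    _ ≤ cr * M := mul_le_mul_of_nonneg_left (hsub.trans (hrow (k + 1))) hcr

/-! ## (J2) E-side columns + node U2's K-uniform matching profile ⇒ node U6 -/

/-- **FROM NODE U2's VARIABLE TO THE COUPLING**, inside the window: for two runs in `]0, γ]` (run A below the cutoff `K`, run B below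
`K + 1`) and `i ≤ K`, `|g^A_i − g^B_{i+1}| ≤ γ³·disc g^A g^B i` (`T4CouplingMatching.abs_sub_le_of_inv_sq`: `|a − b| ≤ a²b·|1∕a² − 1∕b²|`,
and `a²b ≤ γ³`). [folklore] -/
theorem couplingDisc_le_of_disc {γ : ℝ} {K : ℕ} {gA gB : ℕ → ℝ}
    (hA : ∀ i, i ≤ K → 0 < gA i ∧ gA i ≤ γ) (hB : ∀ i, i ≤ K + 1 → 0 < gB i ∧ gB i ≤ γ) {i : ℕ} (hi : i ≤ K) :
    |gA i - gB (i + 1)| ≤ γ ^ 3 * disc gA gB i := by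
  obtain ⟨ha0, haγ⟩ := hA i hi
  obtain ⟨hb0, hbγ⟩ := hB (i + 1) (Nat.succ_le_succ hi)
  have hγ : 0 ≤ γ := ha0.le.trans haγ
  have h1 := abs_sub_le_of_inv_sq ha0 hb0
  have hw : gA i ^ 2 * gB (i + 1) ≤ γ ^ 3 := by
    calc gA i ^ 2 * gB (i + 1) ≤ γ ^ 2 * γ :=
          mul_le_mul (pow_le_pow_left₀ ha0.le haγ 2) hbγ hb0.le (pow_nonneg hγ 2)
      _ = γ ^ 3 := by ring
  calc |gA i - gB (i + 1)| ≤ gA i ^ 2 * gB (i + 1) * |1 / gA i ^ 2 - 1 / gB (i + 1) ^ 2| := h1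
    _ ≤ γ ^ 3 * |1 / gA i ^ 2 - 1 / gB (i + 1) ^ 2| := mul_le_mul_of_nonneg_right hw (abs_nonneg _)
    _ = γ ^ 3 * disc gA gB i := rfl

/-- Under a K-uniform matching profile `disc (g K) (g (K+1)) j ≤ p_j` (`j ≤ K`) in the window, U3's coupling bracket of the run pair
`(g K, g (K+1) ∘ succ)` at a creation step `j ≤ K` is `≤ Σ_{i<j} Λ j i·(γ³·p_i)` — a cutoff-INDEPENDENT majorant. [folklore] -/
theorem historySum_le_profile {Λ : ℕ → ℕ → ℝ} (hΛ : ∀ k i, i ≤ k → 0 ≤ Λ k i) {g : ℕ → ℕ → ℝ} {γ : ℝ} {p : ℕ → ℝ}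
    (hbox : ∀ K i, i ≤ K → 0 < g K i ∧ g K i ≤ γ) (hdisc : ∀ K j, j ≤ K → disc (g K) (g (K + 1)) j ≤ p j)
    {K j : ℕ} (hj : j ≤ K) :
    ∑ i ∈ range j, Λ j i * |g K i - g (K + 1) (i + 1)| ≤ ∑ i ∈ range j, Λ j i * (γ ^ 3 * p i) := by
  refine sum_le_sum fun i hi => ?_
  have hij : i < j := mem_range.mp hi
  have hiK : i ≤ K := (hij.le).trans hj
  have hγ : 0 ≤ γ := (hbox K i hiK).1.le.trans (hbox K i hiK).2
  refine mul_le_mul_of_nonneg_left ?_ (hΛ j i hij.le)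
  exact (couplingDisc_le_of_disc (hbox K) (hbox (K + 1)) hiK).trans
    (mul_le_mul_of_nonneg_left (hdisc K i hiK) (pow_nonneg hγ 3))

/-- **(J2) COLUMNS + ANY K-UNIFORM SUMMABLE MATCHING PROFILE ⇒ NODE U6.**  Nonnegative E-side moduli with column sums `≤ M_c`, a family
of runs `K ↦ g K` in the window `]0, γ]`, node U2's matching in the K-uniform form `disc (g K) (g (K+1)) j ≤ p_j` for `j ≤ K` with
`p ≥ 0` summable, and an injection dominated by U3's coupling bracket of the consecutive runs
(`0 ≤ inj K j ≤ Σ_{i<j} Λ j i·|g^K_i − g^{K+1}_{i+1}|`, `j ≤ K`): then `Summable (T4CauchySum.delta E ρ inj)` for every `0 ≤ E`, `0 ≤ ρ < 1`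
(`SchurMemory.summable_delta_of_colSum` with the profile `d_i = γ³·p_i`).  No `FadingMemory` on either side. [folklore] -/
theorem summable_delta_of_colSum_profile {Λ : ℕ → ℕ → ℝ} {Mc : ℝ} (hΛ : ∀ k i, i ≤ k → 0 ≤ Λ k i)
    (hcol : ∀ i N, ∑ k ∈ Ico (i + 1) N, Λ k i ≤ Mc)
    {g : ℕ → ℕ → ℝ} {γ : ℝ} {p : ℕ → ℝ} (hbox : ∀ K i, i ≤ K → 0 < g K i ∧ g K i ≤ γ)
    (hdisc : ∀ K j, j ≤ K → disc (g K) (g (K + 1)) j ≤ p j) (hp0 : ∀ j, 0 ≤ p j) (hp : Summable p)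
    {E ρ : ℝ} (hE : 0 ≤ E) (hρ : 0 ≤ ρ) (hρ1 : ρ < 1) {inj : ℕ → ℕ → ℝ}
    (hinj : ∀ K j : ℕ, j ≤ K → 0 ≤ inj K j ∧ inj K j ≤ ∑ i ∈ range j, Λ j i * |g K i - g (K + 1) (i + 1)|) :
    Summable (delta E ρ inj) := by
  have hγ : 0 ≤ γ := (hbox 0 0 le_rfl).1.le.trans (hbox 0 0 le_rfl).2
  have hd0 : ∀ i, 0 ≤ γ ^ 3 * p i := fun i => mul_nonneg (pow_nonneg hγ 3) (hp0 i)
  refine summable_delta_of_colSum hΛ hcol hd0 (hp.mul_left (γ ^ 3)) hE hρ hρ1 fun K j hj => ⟨(hinj K j hj).1, ?_⟩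
  exact (hinj K j hj).2.trans (historySum_le_profile hΛ hbox hdisc hj)

/-- **THE RECORD'S REGIME** (node U2 WITH β-side `FadingMemory`: `T4CouplingMatching.disc_le_of_fadingMemory` gives the geometric profile
`p_j = C·θ^j`, `0 ≤ θ < 1`, `C ≥ 0`): E-side COLUMNS suffice for node U6. [folklore] -/
theorem summable_delta_of_colSum_geometric {Λ : ℕ → ℕ → ℝ} {Mc : ℝ} (hΛ : ∀ k i, i ≤ k → 0 ≤ Λ k i)
    (hcol : ∀ i N, ∑ k ∈ Ico (i + 1) N, Λ k i ≤ Mc)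
    {g : ℕ → ℕ → ℝ} {γ Cθ θ : ℝ} (hbox : ∀ K i, i ≤ K → 0 < g K i ∧ g K i ≤ γ) (hC : 0 ≤ Cθ) (hθ0 : 0 ≤ θ) (hθ1 : θ < 1)
    (hdisc : ∀ K j, j ≤ K → disc (g K) (g (K + 1)) j ≤ Cθ * θ ^ j)
    {E ρ : ℝ} (hE : 0 ≤ E) (hρ : 0 ≤ ρ) (hρ1 : ρ < 1) {inj : ℕ → ℕ → ℝ}
    (hinj : ∀ K j : ℕ, j ≤ K → 0 ≤ inj K j ∧ inj K j ≤ ∑ i ∈ range j, Λ j i * |g K i - g (K + 1) (i + 1)|) :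
    Summable (delta E ρ inj) :=
  summable_delta_of_colSum_profile hΛ hcol hbox hdisc (fun j => mul_nonneg hC (pow_nonneg hθ0 j))
    ((summable_geometric_of_lt_one hθ0 hθ1).mul_left Cθ) hE hρ hρ1 hinj

/-- **(E33g)'s REGIME — NO `FadingMemory` ON EITHER SIDE.**  With node U2's K-uniform STRETCHED matching
`disc (g K) (g (K+1)) j ≤ L·ρ₂^⌊√j⌋` (`0 ≤ ρ₂ < 1`, `L ≥ 0`; the hypothesis `hstr` of
`EriceRemainderEnclosureHistoryRenewalStretched.tendsto_invSq_tail_of_uniform`, produced by its `disc_le_sqrt_uniform_sign` from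
`ScaleShiftRate` + β-side ROW-bounded `HistLipschitz` + sign + floor + `M·U ≤ ρ₂²`) and E-side COLUMN-bounded NE9 moduli, node U6's
`Summable (T4CauchySum.delta E ρ inj)` holds for every injection under U3's coupling bracket (`summable_pow_sqrt` BY NAME). [folklore] -/
theorem summable_delta_of_colSum_sqrt {Λ : ℕ → ℕ → ℝ} {Mc : ℝ} (hΛ : ∀ k i, i ≤ k → 0 ≤ Λ k i)
    (hcol : ∀ i N, ∑ k ∈ Ico (i + 1) N, Λ k i ≤ Mc)
    {g : ℕ → ℕ → ℝ} {γ L ρ₂ : ℝ} (hbox : ∀ K i, i ≤ K → 0 < g K i ∧ g K i ≤ γ) (hL : 0 ≤ L) (hρ₂0 : 0 ≤ ρ₂) (hρ₂1 : ρ₂ < 1)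
    (hstr : ∀ K j, j ≤ K → disc (g K) (g (K + 1)) j ≤ L * ρ₂ ^ Nat.sqrt j)
    {E ρ : ℝ} (hE : 0 ≤ E) (hρ : 0 ≤ ρ) (hρ1 : ρ < 1) {inj : ℕ → ℕ → ℝ}
    (hinj : ∀ K j : ℕ, j ≤ K → 0 ≤ inj K j ∧ inj K j ≤ ∑ i ∈ range j, Λ j i * |g K i - g (K + 1) (i + 1)|) :
    Summable (delta E ρ inj) :=
  summable_delta_of_colSum_profile hΛ hcol hbox hstr (fun j => mul_nonneg hL (pow_nonneg hρ₂0 (Nat.sqrt j)))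
    ((summable_pow_sqrt hρ₂0 hρ₂1).mul_left L) hE hρ hρ1 hinj

end Summit.QuantumFields.BalabanUV.T4Continuum.NE9.SchurMemoryJunction
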